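import Summits.CriticalPhenomena.CardyFormulaZ2.Theses.CardyMagicRigidity
import Literature.Probability.Percolation.CardyFormulaConformalInvariance
import Literature.Probability.Percolation.BoxCrossingUpperBound
import Literature.Probability.Percolation.ZdNearCriticalWindow
import Literature.Probability.Percolation.HalfSpacePinnedPairs
import Literature.Probability.Percolation.SharpnessDCTProofs
import Literature.Probability.RandomPlanarGeometry.ConformalRectangleProofs
import Literature.Probability.Percolation.TriPlateLoopArc
import Literature.Probability.Percolation.ZdPlateArcBlocking
import Literature.Probability.Percolation.FullPlaneCNL
import Literature.Probability.Percolation.AnnulusCrossingBound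
import Literature.Probability.Percolation.TriAnnulusCrossing
import Literature.Probability.Percolation.PlateCrossingEvents

/-!
# Stub C-T1 of line `oracle-sandwich` (crux `LoopsToCrossings`, stmt-CriticalPhenomena-4837):
# vertical loop sub-arcs transfer from `𝕋` to `ℤ²`

`stub_transferVerticalTtoZ` (registered statement, proved verbatim): if the site configuration
`ω'` of `δ𝕋` has an OPEN and a CLOSED vertical crossing of the plate `Φ([-x,x] × [-yout,yout])`
between the zones `Φ{im ≤ -yin}`, `Φ{yin ≤ im}`, and the typed loop configurations of the bond
configuration `ω ⊆ E(ℤ²)` and of `ω'` are `η`-close (`LoopConfig.IsClose η`) with no arms across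
the window annulus, then `ω` has no primal and no dual horizontal crossing of the `c`-roomier plate
`Φ([-xout, xout] × [-(yin - c), yin - c])` between `Φ{re ≤ -(x + c)}` and `Φ{x + c ≤ re}`.

Proof = composition of the two Literature theorems landed for this stub:
* `exists_siteLoop_arc_of_triPlateV` (`TriPlateLoopArc.lean`, T1a, pure `𝕋` + plane topology):
  the separating honeycomb interface loop has a parameter sub-arc inside
  `Φ(plateBox (x + c/2) yin)` joining `Φ{im ≤ -(yin - c/2)}` to `Φ{yin - c/2 ≤ im}`, with trace
  in `B(0, W₁ + 1) ⊆ B(0, 1/η)`;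
* `not_mem_zdMonoPlateH_of_closeArc` (`ZdPlateArcBlocking.lean`, T1b, coupling + `ℤ²`): such an
  arc, `η`-close to the medial loops of `ω`, blocks every monochromatic horizontal crossing of
  `H(x + c, xout, yin - c)` (stretch of darts of the partner loop, open walk on its left, dual-open
  walk on its right, plus-position blocking).
Sources: Camia–Newman, CMP 268 (2006), §5; DKKMO arXiv:2012.11672v2, §5.2.
-/

noncomputable section

namespace Summit.CriticalPhenomena.CardyFormulaZ2.Cruxes.LoopsToCrossings.OracleSandwich

open Summit.CriticalPhenomena.CardyFormulaZ2.Theses.CardyMagicRigidity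
open Literature.Probability.RandomPlanarGeometry hiding cardyFunction
open Literature.Probability.Percolation hiding cardyFunction
open Literature.Probability.LatticeModels
open Filter Topology Set MeasureTheory Metric

/-- **Stub C-T1 — vertical loop sub-arcs transfer from `𝕋` to `ℤ²`** (deterministic, two
configurations; the only places where the COUPLING enters stub C are this stub and its mirror T2).
Data: a chart `Φ`, a room `c > 0`; then a coupling scale `η ≤ η₀(Φ, c)`, a mesh `δ ≤ δ₀`, window radii
`W₀ < W₁` with `Φ([-2,2]²) ⊆ B̄(0, W₀)` and `W₁ + 1 ≤ 1/η`; a bond configuration `ω ⊆ E(ℤ²)` and a site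
configuration `ω'` whose typed loop configurations (`bondLoopConfig δ 0 ω`, DKKMO medial loops of
`δℤ²`; `siteLoopConfig δ ω'`, honeycomb interface loops of `δ𝕋`, both typed by orientation) are
`η`-close in DKKMO's sense (`LoopConfig.IsClose η`: every loop inside `B(0, 1/η)` has a same-type
partner at `udist ≤ η`, both ways), with NO primal/dual arm of `δℤ²` and NO open/closed arm of `δ𝕋`
from `B̄(0,W₀)` to distance `W₁` (tree events `annulusOpenCrossing`, `annulusDualCrossing`,
`triAnnulusCrossing`).  Claim: if `ω'` has an OPEN and a CLOSED vertical plate crossing of the same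
plate `Φ([-x,x] × [-yout,yout])` between the zones `Φ{im ≤ -yin}`, `Φ{yin ≤ im}`, then `ω` has NO
primal and NO dual horizontal plate crossing of any plate whose zones lie `c` beyond `±x` and whose
height is `yin - c`.  Proof: `exists_siteLoop_arc_of_triPlateV` (T1a: separation by winding
numbers, continuum duality in the chart rectangle, sub-arc of the simple hexagonal polygon) and
`not_mem_zdMonoPlateH_of_closeArc` (T1b: partner medial loop at `udist ≤ η`, stretch of darts
`2η`-close to the arc, open walk on the left / dual-open walk on the right, plus-position
blocking). [cite: CamiaNewman2006, §5] -/
theorem stub_transferVerticalTtoZ :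
    ∀ (Φ : ℂ ≃ₜ ℂ) (c : ℝ), 0 < c → ∃ η₀ : ℝ, 0 < η₀ ∧ ∀ η : ℝ, 0 < η → η ≤ η₀ →
      ∃ δ₀ : ℝ, 0 < δ₀ ∧ ∀ δ : ℝ, 0 < δ → δ ≤ δ₀ →
        ∀ (W₀ W₁ : ℝ), Φ '' (Icc (-2) 2 ×ℂ Icc (-2) 2) ⊆ ball (0 : ℂ) W₀ → W₀ < W₁ → W₁ + 1 ≤ 1 / η →
        ∀ (x yin yout : ℝ), c ≤ x → x + c ≤ 2 → 2 * c ≤ yin → yin ≤ yout → yout ≤ 2 →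
        ∀ (ω : BondConfig (Site 2)) (ω' : SiteConfig (Site 2)), ω ⊆ (zdGraph 2).edgeSet →
          LoopConfig.IsClose η (bondLoopConfig δ 0 ω) (siteLoopConfig δ ω') →
          (ω ∉ annulusOpenCrossing 0 δ W₀ W₁ ∧ ω ∉ annulusDualCrossing 0 δ W₀ W₁) →
          (ω' ∉ triAnnulusCrossing true δ 0 W₀ W₁ ∧ ω' ∉ triAnnulusCrossing false δ 0 W₀ W₁) →
          (∃ u ∈ {w : Site 2 | triMeshPoint δ w ∈ Φ '' {z : ℂ | z.im ≤ -yin}},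
            ∃ v ∈ {w : Site 2 | triMeshPoint δ w ∈ Φ '' {z : ℂ | yin ≤ z.im}},
              ω' ∈ siteConnIn triGraph {w | triMeshPoint δ w ∈ Φ '' (Icc (-x) x ×ℂ Icc (-yout) yout)} u v) →
          (∃ u ∈ {w : Site 2 | triMeshPoint δ w ∈ Φ '' {z : ℂ | z.im ≤ -yin}},
            ∃ v ∈ {w : Site 2 | triMeshPoint δ w ∈ Φ '' {z : ℂ | yin ≤ z.im}},
              ω'ᶜ ∈ siteConnIn triGraph {w | triMeshPoint δ w ∈ Φ '' (Icc (-x) x ×ℂ Icc (-yout) yout)} u v) →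
          ∀ xout : ℝ, xout ≤ 2 →
            ω ∉ openCrossing {w : Site 2 | meshPoint δ w ∈ Φ '' (Icc (-xout) xout ×ℂ Icc (-(yin - c)) (yin - c))}
                {w | meshPoint δ w ∈ Φ '' {z : ℂ | z.re ≤ -(x + c)}} {w | meshPoint δ w ∈ Φ '' {z : ℂ | x + c ≤ z.re}} ∧
            dualConfig ω ∉ openCrossing
                {w : Site 2 | dualScale δ (Site.toComplex w) ∈ Φ '' (Icc (-xout) xout ×ℂ Icc (-(yin - c)) (yin - c))}
                {w | dualScale δ (Site.toComplex w) ∈ Φ '' {z : ℂ | z.re ≤ -(x + c)}}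
                {w | dualScale δ (Site.toComplex w) ∈ Φ '' {z : ℂ | x + c ≤ z.re}} := by
  intro Φ c hc
  obtain ⟨η₁, hη₁, hB⟩ := not_mem_zdMonoPlateH_of_closeArc Φ c hc
  refine ⟨η₁, hη₁, fun η hη hηle ↦ ?_⟩
  obtain ⟨δa, hδa, hA⟩ := exists_siteLoop_arc_of_triPlateV Φ c hc
  obtain ⟨δ₁, hδ₁, hB'⟩ := hB η hη hηle
  refine ⟨min δa δ₁, lt_min hδa hδ₁, fun δ hδ hδle ↦ ?_⟩
  intro W₀ W₁ hW hW₀₁ hηW x yin yout hx hx2 hyin hyio hyout ω ω' hE hC _hwz hwt hVo hVc xout hxout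
  obtain ⟨f, w, hw, hrange, β, s, t, hβ, hst, hband, hbot, htop⟩ :=
    hA δ hδ (hδle.trans (min_le_left _ _)) W₀ W₁ hW hW₀₁ x yin yout hx hx2 hyin hyio hyout ω' hwt hVo hVc
  have hrange' : (siteLoopCurve δ w).range ⊆ ball (0 : ℂ) (1 / η) :=
    hrange.trans (ball_subset_ball hηW)
  have key : ω ∉ zdMonoPlateH Φ δ (x + c) xout (yin - c) :=
    hB' δ hδ (hδle.trans (min_le_right _ _)) x yin hx hx2 hyin (hyio.trans hyout) ω ω' hE hC f w hw
      hrange' β s t hβ hst hband hbot htop xout hxout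
  exact ⟨fun h ↦ key (Or.inl h), fun h ↦ key (Or.inr h)⟩

end Summit.CriticalPhenomena.CardyFormulaZ2.Cruxes.LoopsToCrossings.OracleSandwich

end
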